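import Summits.Ventures.HSemireg.ObstructionLocusBlockNormal

/-!
# Venture HSemireg — (S5) OBSTRUCTION LOCUS away from secant type, XXI: the BLOCK MODELS — one block `S = [n]`:
# files VIII/IX's L1 (i) `Hom_R(I_W, R/I_W) ≃ Π_k Π_{j ≠ k} R/(x_j, x_k)` recovered WITHOUT the domain hypothesis

HONEST FRAMING.  Companion of `ObstructionLocusBlockNormal.lean` (cell `pub-hsemireg`, track «S4-PUSH» (ii), seat
s4-prove-2; vocabulary and honest framing as there): plain commutative algebra; nothing here constructs a variety or a
sheaf; nothing here says that HC / HC_CM / HC_AV holds; no Literature fact is declared or used.  A re-indexing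
corollary only: the multi-block lemma `blockNormalModuleEquivNested` for the one-block structure `S = [n]`
(`Blocks.full n`, whose arrangement ideal is file VIII's `srDesignIdeal K n` by `arrIdeal_single` + `blockIdeal_univ`),
transported to the literal index set and ideal of file IX's `normalModuleEquiv` — now for EVERY commutative coefficient
ring `K` (file IX assumed `[IsDomain K]` for its Hilbert–Burch step; the block route needs no presentation of `I_W`).

* `Blocks.full n` (`n ≥ 1`), `arrIdeal_full` (`= srDesignIdeal K n`), `nestedFullEquiv` (re-indexing
  `Unit × ↥univ × ↥(univ ∖ a)` to `(k, {j // j ≠ k})`), **`normalModuleEquiv'`** :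
  `Hom_R(I_W, R/I_W) ≃ₗ[R] Π_k Π_{j ≠ k} R/(x_j, x_k)`, any commutative `K`, `n ≥ 1`.
(Scope, s4-ref P-1 on file XIX: for `n = 1` the single block is a singleton, `I_W = R` and both sides are trivial —
the statement is true but vacuous; the geometric case is `n ≥ 2`.)
References (dictionary only): G2-REDUCIBLE-POINT-THEOREM.md §2 L1 (i); EXT-NOTE.md §6.B(a) (r = 1).
-/

open scoped BigOperators
open MvPolynomial Finset

namespace Summit.Ventures.HSemireg.ObstructionLocus.BlockModel

variable {K : Type*} [CommRing K] {n : ℕ}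

/-- The one-block structure `S = [n]` (for `n ≥ 1`). -/
def Blocks.full (n : ℕ) [NeZero n] : Blocks Unit n :=
  Blocks.single (Finset.univ : Finset (Fin n)) ⟨0, Finset.mem_univ _⟩

/-- Its arrangement ideal is file VIII's `I_W = srDesignIdeal K n`. -/
theorem arrIdeal_full [NeZero n] : arrIdeal K (Blocks.full n) = srDesignIdeal K n := by
  rw [Blocks.full, arrIdeal_single, blockIdeal_univ]

variable (K n) in
/-- Re-indexing the nested branch functions of the one-block structure to files VIII/IX's index set
`(k : Fin n) → {j // j ≠ k} → R/(x_j, x_k)`. -/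
noncomputable def nestedFullEquiv [NeZero n] :
    NestedBranchFunctions K (Blocks.full n) ≃ₗ[MvPolynomial (Fin n) K]
      ((k : Fin n) → (j : {j : Fin n // j ≠ k}) →
        MvPolynomial (Fin n) K ⧸ Ideal.span {(X j.1 : MvPolynomial (Fin n) K), X k}) :=
  (LinearEquiv.funUnique Unit (MvPolynomial (Fin n) K)
      ((a : ↥(Finset.univ : Finset (Fin n))) → (b : ↥((Finset.univ : Finset (Fin n)).erase a.1)) →
        MvPolynomial (Fin n) K ⧸ Ideal.span {(X b.1 : MvPolynomial (Fin n) K), X a.1})) ≪≫ₗ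
    ((LinearEquiv.piCongrLeft (MvPolynomial (Fin n) K)
        (fun a : ↥(Finset.univ : Finset (Fin n)) => (b : ↥((Finset.univ : Finset (Fin n)).erase a.1)) →
          MvPolynomial (Fin n) K ⧸ Ideal.span {(X b.1 : MvPolynomial (Fin n) K), X a.1})
        (Equiv.subtypeUnivEquiv (fun k : Fin n => Finset.mem_univ k)).symm).symm ≪≫ₗ
      LinearEquiv.piCongrRight fun k : Fin n =>
        (LinearEquiv.piCongrLeft (MvPolynomial (Fin n) K)
          (fun b : ↥((Finset.univ : Finset (Fin n)).erase k) =>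
            MvPolynomial (Fin n) K ⧸ Ideal.span {(X b.1 : MvPolynomial (Fin n) K), X k})
          (Equiv.subtypeEquivRight (fun j : Fin n => by
            rw [Finset.mem_erase]; exact (and_iff_left (Finset.mem_univ j)).symm))).symm)

variable (K n) in
/-- **Files VIII/IX's L1 (i) WITHOUT the domain hypothesis**: for every commutative ring `K` and `n ≥ 1`,
`Hom_R(I_W, R/I_W) ≃ₗ[R] Π_k Π_{j ≠ k} R/(x_j, x_k)` — the one-block case of the multi-block lemma, transported to the
literal index set and ideal of file IX's `normalModuleEquiv`. -/
noncomputable def normalModuleEquiv' [NeZero n] :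
    (↥(srDesignIdeal K n) →ₗ[MvPolynomial (Fin n) K] MvPolynomial (Fin n) K ⧸ srDesignIdeal K n)
      ≃ₗ[MvPolynomial (Fin n) K]
        ((k : Fin n) → (j : {j : Fin n // j ≠ k}) →
          MvPolynomial (Fin n) K ⧸ Ideal.span {(X j.1 : MvPolynomial (Fin n) K), X k}) :=
  (LinearEquiv.arrowCongr (LinearEquiv.ofEq _ _ (arrIdeal_full (K := K) (n := n)))
      (Submodule.quotEquivOfEq _ _ (arrIdeal_full (K := K) (n := n)))).symm
    ≪≫ₗ blockNormalModuleEquivNested K (Blocks.full n) ≪≫ₗ nestedFullEquiv K n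

end Summit.Ventures.HSemireg.ObstructionLocus.BlockModel
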